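import Literature.Analysis.Hypoelliptic.FieldLink
import Literature.Analysis.Hypoelliptic.Bootstrap
import HarnessLib

/-!
# The globalised Hörmander data on the Fourier side and its spanning hypothesis

Analysis/Hypoelliptic support file serving the discharge of
`Literature.Analysis.Distribution.Hormander1967_thm11`: from coefficient families
(`VFlat.CoefFam`) for the sum-of-squares fields, the drift and the zeroth-order term, build

* the symbolic Hörmander data `GData.d : HData V` and the flat data `GData.fd : FlatHData V _`
  with `d.opP.apply = fd.Pf` and `(d.Xs j).apply = fd.Xf j` (`apply_Xs`, `apply_opP`);
* **the spanning hypothesis** `d.SpanHyp` (`GData.spanHyp`) from an `x`-side identity of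
  coefficient families: for each coordinate `k`, a field `Y_k` among the `X_j` with constant part
  `δ_{lk}` and words `w` with real Schwartz coefficients `β_{k,w}` such that
  `Y_k + ∑_w β_{k,w} F_w = ∂_{e_k}` as coefficient families. The Fourier-side identity is exact
  (pointwise on `Nice`): a.e. by the Schwartz-adjoint principle (`SchwartzAdjoint`), and the
  convolution-headed remainder is continuous.

## References

* L. Hörmander, Acta Math. 119 (1967), §3 (3.4); M. E. Taylor, *Pseudodifferential Operators*
  (1981), Ch. XV §1 (folklore bookkeeping).
-/

noncomputable section

open MeasureTheory Set Filter Function SchwartzMap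
open scoped ENNReal NNReal Topology ComplexConjugate InnerProductSpace FourierTransform BigOperators
  ContDiff

namespace Literature.Analysis.Hypoelliptic

open scoped Sym

variable {V : Type*} [NormedAddCommGroup V] [InnerProductSpace ℝ V] [FiniteDimensional ℝ V]
  [MeasurableSpace V] [BorelSpace V]

open Module in
/-- Shorthand for the dimension. [folklore] -/
local notation "nV" => finrank ℝ V

/-! ### Flat fields from coefficient families -/

namespace CoefFam

variable (F : CoefFam V (Module.finrank ℝ V))

/-- The flat field of a coefficient family. [folklore] -/
def toFlat : FlatField V (Fin (Module.finrank ℝ V)) where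
  c := fun k => (F.c k : ℂ)
  θ := fun k => thetaOf (F.a k)
  D := fun k N => 2 ^ N * (Finset.Iic (N, 0)).sup (fun m => SchwartzMap.seminorm ℂ m.1 m.2) (𝓕 (F.a k))
  decay := fun k => rapidDecay_thetaOf (F.a k)

/-- The action of one encoded term. [folklore] -/
theorem apply_coefSym_lin (l : Fin (Module.finrank ℝ V)) (v : V) (G : V → ℂ) (ξ : V) :
    Sym.apply (Sym.comp (F.coefSym l) (Sym.lin v)) G ξ =
      (F.c l : ℂ) * (linMul v ξ * G ξ) + kerOp (convKer (thetaOf (F.a l))) (fun η => linMul v η * G η) ξ := by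
  simp [coefSym, Sym.apply]

/-- **The symbolic field acts as the flat field.** [folklore] -/
theorem apply_toSym_enc (G : V → ℂ) :
    Sym.apply (Field.toSym (F.enc FlatHData.bas)) G = F.toFlat.applyF FlatHData.bas G := by
  ext ξ
  unfold Field.toSym enc FlatField.applyF
  rw [Sym.apply_sum]
  simp only [List.map_ofFn, List.sum_ofFn, Function.comp_def]
  refine Finset.sum_congr rfl fun k _ => ?_
  rw [apply_coefSym_lin]
  rfl

end CoefFam

/-! ### The data -/

variable (V) in
/-- **Input data of the globalised operator**: coefficient families of the sum-of-squares fields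
(including the auxiliary fields `Y_k`), of the (negated, cut off) drift, and the real Schwartz
avatar of the zeroth-order coefficient. [folklore] -/
structure GData where
  /-- number of sum-of-squares fields [folklore] -/
  J : ℕ
  /-- their coefficient families [folklore] -/
  fams : Fin J → CoefFam V (Module.finrank ℝ V)
  /-- the drift's coefficient family [folklore] -/
  fam0 : CoefFam V (Module.finrank ℝ V)
  /-- the zeroth-order coefficient [folklore] -/
  bC : 𝓢(V, ℂ)
  bCreal : ∀ y, conj (bC y) = bC y
  pos : Module.finrank ℝ V ≠ 0

namespace GData

variable (g : GData V)

/-- **The symbolic Hörmander data.** [folklore] -/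
def d : HData V where
  J := g.J
  X := fun j => (g.fams j).enc FlatHData.bas
  X0 := g.fam0.enc FlatHData.bas
  C := Sym.conv (thetaOf g.bC)
  isField := fun j => (g.fams j).isField_enc
  certF := fun j => (g.fams j).certF_enc
  isReal := fun j => (g.fams j).isReal_enc
  ne := fun j => (g.fams j).enc_ne_nil g.pos
  isField0 := g.fam0.isField_enc
  certF0 := g.fam0.certF_enc
  isReal0 := g.fam0.isReal_enc
  ne0 := g.fam0.enc_ne_nil g.pos
  isCoefC := trivial
  certC := ⟨_, rapidDecay_thetaOf g.bC⟩

/-- **The flat Hörmander data.** [folklore] -/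
def fd : FlatHData V g.J where
  X := fun j => (g.fams j).toFlat
  X0 := g.fam0.toFlat
  cC := 0
  θC := thetaOf g.bC
  DC := fun N => 2 ^ N * (Finset.Iic (N, 0)).sup (fun m => SchwartzMap.seminorm ℂ m.1 m.2) (𝓕 g.bC)
  decayC := rapidDecay_thetaOf g.bC

/-- (structural lemma) [folklore] -/
@[simp] theorem d_J : g.d.J = g.J := rfl

/-- **`X_j` acts as the flat field.** [folklore] -/
theorem apply_Xs (j : Fin g.J) (G : V → ℂ) : (g.d.Xs j).apply G = g.fd.Xf j G :=
  (g.fams j).apply_toSym_enc G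

/-- `X₀` acts as the flat drift. [folklore] -/
theorem apply_X0s (G : V → ℂ) : g.d.X0s.apply G = g.fd.X0f G :=
  g.fam0.apply_toSym_enc G

/-- **`P` acts as the flat operator.** [folklore] -/
theorem apply_opP (G : V → ℂ) : g.d.opP.apply G = g.fd.Pf G := by
  ext ξ
  simp only [HData.opP, HData.sqSum, Sym.apply_add, FlatHData.Pf, FlatHData.Cf]
  rw [Sym.apply_sum]
  simp only [List.map_ofFn, List.sum_ofFn, Function.comp_def, Sym.apply_comp]
  have h1 : ∀ j, (g.d.Xs j).apply ((g.d.Xs j).apply G) ξ = g.fd.Xf j (g.fd.Xf j G) ξ := fun j => by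
    rw [apply_Xs, apply_Xs]
  have h2 : g.d.C.apply G ξ = g.fd.cC * G ξ + kerOp (convKer g.fd.θC) G ξ := by
    show kerOp (convKer (thetaOf g.bC)) G ξ = 0 * G ξ + kerOp (convKer (thetaOf g.bC)) G ξ
    ring
  simp only [h1, apply_X0s]
  rw [h2]
  rfl

/-! ### The spanning hypothesis -/

/-- The symbolic commutator of a word of the data. [folklore] -/
def Cword (w : BWord g.J) : Sym V := Cw (e := FlatHData.bas) g.fams g.fam0 w

/-- **Input of the spanning identity for the coordinate `k`**: the index of the field `Y_k`, the
words with their real Schwartz coefficients, and the `x`-side identity of coefficient families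
`Y_k + ∑_i β_i F_{w_i} = ∂_{e_k}`. [folklore] -/
structure SpanData (k : Fin (Module.finrank ℝ V)) where
  /-- the index of `Y_k` among the fields [folklore] -/
  iY : Fin g.J
  /-- number of words [folklore] -/
  m : ℕ
  /-- the words [folklore] -/
  w : Fin m → BWord g.J
  /-- their coefficients [folklore] -/
  β : Fin m → 𝓢(V, ℂ)
  cY : ∀ l, (g.fams iY).c l = if l = k then 1 else 0
  βreal : ∀ i y, conj (β i y) = β i y
  ident : ∀ l y, (g.fams iY).fn l y + ∑ i, β i y * Fw (e := FlatHData.bas) g.fams g.fam0 (w i) l y =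
    if l = k then 1 else 0

namespace SpanData

variable {g} {k : Fin (Module.finrank ℝ V)} (sd : g.SpanData k)

/-- The coefficient expression attached to the `i`-th word: `sgn w_i · conv θ_{β_i}`. [folklore] -/
def coefOf (i : Fin sd.m) : Sym V :=
  Sym.smul (sgn (sd.w i)) (Sym.conv (thetaOf (sd.β i)))

/-- **The list `L k`** of the spanning hypothesis. [folklore] -/
def L : List (Sym V × BWord g.J) :=
  (Sym.cmul 1, BWord.base sd.iY) :: List.ofFn fun i => (sd.coefOf i, sd.w i)

/-- The entries of `L k` are certified coefficient expressions. [folklore] -/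
theorem isCoef_cert : ∀ p ∈ sd.L, Sym.IsCoef p.1 ∧ Sym.Cert p.1 := by
  intro p hp
  simp only [L, List.mem_cons, List.mem_ofFn] at hp
  rcases hp with rfl | ⟨i, rfl⟩
  · exact ⟨trivial, trivial⟩
  · exact ⟨trivial, ⟨_, rapidDecay_thetaOf (sd.β i)⟩⟩

/-- The symbolic side with `Cw` in place of `fieldOf`. [folklore] -/
def S' : Sym V := Sym.sum (sd.L.map fun p => Sym.comp p.1 (g.Cword p.2))

/-- The symbolic side of the spanning hypothesis. [folklore] -/
def S : Sym V := Sym.sum (sd.L.map fun p => Sym.comp p.1 (Field.toSym (g.d.fieldOf p.2)))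

/-- `toSym (fieldOf w) ≈ Cw w`. [folklore] -/
theorem toSym_fieldOf_equiv : ∀ w : BWord g.J,
    Field.toSym (g.d.fieldOf w) ≈ Cw (e := FlatHData.bas) g.fams g.fam0 w
  | BWord.base _ => Sym.Equiv.rfl
  | BWord.base0 => Sym.Equiv.rfl
  | BWord.consJ j w => by
    have ih := toSym_fieldOf_equiv w
    have hb := Field.comm_toSym (g.d.isField j) (g.d.certF j) (g.d.isField_fieldOf w) (g.d.certF_fieldOf w)
    refine hb.symm.trans ?_
    exact Sym.Equiv.comm Sym.Equiv.rfl ih (g.d.certF j).cert_toSym (g.d.certF_fieldOf w).cert_toSym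
  | BWord.cons0 w => by
    have ih := toSym_fieldOf_equiv w
    have hb := Field.comm_toSym g.d.isField0 g.d.certF0 (g.d.isField_fieldOf w) (g.d.certF_fieldOf w)
    refine hb.symm.trans ?_
    exact Sym.Equiv.comm Sym.Equiv.rfl ih g.d.certF0.cert_toSym (g.d.certF_fieldOf w).cert_toSym

omit sd in
/-- Sums of termwise equivalent lists are equivalent. [folklore] -/
theorem sum_map_equiv {α : Type*} (l : List α) {f f' : α → Sym V} (h : ∀ a ∈ l, f a ≈ f' a) :
    Sym.sum (l.map f) ≈ Sym.sum (l.map f') := by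
  intro F hF
  rw [Sym.apply_sum, Sym.apply_sum]
  ext ξ
  simp only [List.map_map]
  congr 1
  refine List.map_congr_left fun a ha => ?_
  simp only [Function.comp_apply]
  rw [h a ha F hF]

/-- `S ≈ S'`. [folklore] -/
theorem S_equiv_S' : sd.S ≈ sd.S' :=
  sum_map_equiv _ fun p _ => (toSym_fieldOf_equiv p.2).comp_right _

/-- `S'` is good. [folklore] -/
theorem good_S' : Sym.Good sd.S' := by
  refine Sym.Good.sum fun s hs => ?_
  obtain ⟨p, hp, rfl⟩ := List.mem_map.1 hs
  simp only [L, List.mem_cons, List.mem_ofFn] at hp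
  rcases hp with rfl | ⟨i, rfl⟩
  · exact (Sym.Good.cmul 1).comp (good_Cw _)
  · exact ((Sym.Good.conv _).smul _).comp (good_Cw _)

/-! #### The differential operators agree -/

omit [MeasurableSpace V] [BorelSpace V] in
/-- The smooth families entering the identity. [folklore] -/
theorem smoothFam_βFw (i : Fin sd.m) :
    SmoothFam (fun l z => sd.β i z * Fw (e := FlatHData.bas) g.fams g.fam0 (sd.w i) l z) := fun l =>
  ((sd.β i).smooth ⊤).mul (smoothFam_Fw (sd.w i) l)

/-- `dx` of the head term. [folklore] -/
theorem dx_head {h : V → ℂ} (hh : ContDiff ℝ ∞ h) :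
    Sym.dx (Sym.comp (Sym.cmul 1) (g.Cword (BWord.base sd.iY))) h =
      fun y => flatC FlatHData.bas (g.fams sd.iY).fn h y := by
  rw [Sym.dx_comp, Sym.dx_cmul, map_one]
  unfold Cword
  rw [(good_Cw _).dx_const_mul 1 hh, dx_Cw _ hh]
  ext y; simp [sgn, Fw]

/-- `dx` of a word term. [folklore] -/
theorem dx_term (i : Fin sd.m) {h : V → ℂ} (hh : ContDiff ℝ ∞ h) :
    Sym.dx (Sym.comp (sd.coefOf i) (g.Cword (sd.w i))) h =
      fun y => flatC FlatHData.bas (fun l z => sd.β i z * Fw (e := FlatHData.bas) g.fams g.fam0 (sd.w i) l z) h y := by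
  rw [Sym.dx_comp, coefOf, Sym.dx_smul]
  simp only [Sym.dx_conv_thetaOf]
  unfold Cword
  have hβh : ContDiff ℝ ∞ (fun y => sd.β i y * h y) := ((sd.β i).smooth ⊤).mul hh
  rw [(good_Cw _).dx_const_mul _ hβh, dx_Cw _ hβh, flatC_mul_fam]
  ext y
  rw [← mul_assoc, mul_comm (conj _), sgn_mul_conj, one_mul]

/-- **`dx S' h = ∂_{e_k} h`** for smooth `h`. [folklore] -/
theorem dx_S' {h : V → ℂ} (hh : ContDiff ℝ ∞ h) : Sym.dx sd.S' h = fun y => pd FlatHData.bas k h y := by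
  unfold S' L
  rw [Sym.dx_sum]
  ext y
  rw [List.map_cons, List.map_cons, List.sum_cons, List.map_ofFn, List.map_ofFn, List.sum_ofFn]
  simp only [Function.comp_def]
  rw [sd.dx_head hh]
  simp only [sd.dx_term _ hh]
  rw [← flatC_sum_fam Finset.univ sd.smoothFam_βFw hh,
    ← flatC_add_fam (g.fams sd.iY).smooth (fun l => ContDiff.sum fun i _ => sd.smoothFam_βFw i l) hh,
    ← flatC_single k h y]
  congr 1
  ext l z
  exact sd.ident l z

/-! #### The remainder and its continuity -/

/-- The convolution-headed remainder. [folklore] -/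
def R (F : V → ℂ) (ξ : V) : ℂ :=
  (∑ l, kerOp (convKer (thetaOf ((g.fams sd.iY).a l))) (fun η => linMul (FlatHData.bas l) η * F η) ξ) +
    ∑ i, sgn (sd.w i) *
      kerOp (convKer (thetaOf (sd.β i))) (Sym.apply (g.Cword (sd.w i)) F) ξ

/-- **`S' F = ∂̂_k F + R F`** pointwise. [folklore] -/
theorem apply_S' (F : V → ℂ) (ξ : V) :
    Sym.apply sd.S' F ξ = linMul (FlatHData.bas k) ξ * F ξ + sd.R F ξ := by
  unfold S' L R
  rw [Sym.apply_sum]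
  simp only
  rw [List.map_cons, List.map_cons, List.sum_cons, List.map_ofFn, List.map_ofFn, List.sum_ofFn]
  simp only [Function.comp_def, Sym.apply_comp, Sym.apply_cmul, one_mul]
  -- the head: `toSym (enc Y_k) F = ∑_l (c_l ∂̂_l F + conv_l ∂̂_l F)` with `c_l = δ_{lk}`
  have hhead : Sym.apply (g.Cword (BWord.base sd.iY)) F ξ =
      linMul (FlatHData.bas k) ξ * F ξ +
        ∑ l, kerOp (convKer (thetaOf ((g.fams sd.iY).a l))) (fun η => linMul (FlatHData.bas l) η * F η) ξ := by
    show Sym.apply (Field.toSym ((g.fams sd.iY).enc FlatHData.bas)) F ξ = _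
    rw [(g.fams sd.iY).apply_toSym_enc F]
    simp only [FlatField.applyF, CoefFam.toFlat, FlatField.L, Finset.sum_add_distrib, sd.cY]
    congr 1
    rw [Finset.sum_eq_single k]
    · simp
    · intro l _ hl; simp [hl]
    · intro hk; exact absurd (Finset.mem_univ k) hk
  rw [hhead]
  -- the word terms
  have hterm : ∀ i, Sym.apply (sd.coefOf i) (Sym.apply (g.Cword (sd.w i)) F) ξ =
      sgn (sd.w i) *
        kerOp (convKer (thetaOf (sd.β i))) (Sym.apply (g.Cword (sd.w i)) F) ξ := fun i => by
    simp [coefOf, Sym.apply]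
  simp only [hterm]
  ring

/-- The remainder is continuous for `F ∈ Nice`. [folklore] -/
theorem continuous_R {F : V → ℂ} (hF : Nice F) : Continuous (sd.R F) := by
  unfold R
  refine Continuous.add (continuous_finsetSum _ fun l _ => ?_) (continuous_finsetSum _ fun i _ => ?_)
  · exact continuous_kerOp_convKer_thetaOf _ (((mulBound_linMul _).nice_mul hF).inH 0)
  · exact continuous_const.mul
      (continuous_kerOp_convKer_thetaOf _ (((good_Cw (sd.w i)).cert.nice_apply hF).inH 0))

/-! #### The spanning hypothesis -/

/-- **`∂̂_k ≈ S'`**, exactly. [folklore] -/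
theorem lin_equiv_S' : Sym.lin (FlatHData.bas (V := V) k) ≈ sd.S' := by
  intro F hF
  -- a.e. by the Schwartz-adjoint principle
  have hae : Sym.apply sd.S' F =ᵐ[volume] Sym.apply (Sym.lin (FlatHData.bas k)) F := by
    refine sd.good_S'.apply_ae_eq (Sym.Good.lin _) (fun ψ => ?_) hF
    rw [sd.dx_S' ((𝓕 ψ).smooth ⊤)]
    rfl
  -- hence the continuous remainder vanishes a.e., hence everywhere
  have hR : sd.R F =ᵐ[volume] fun _ => (0 : ℂ) := by
    filter_upwards [hae] with ξ hξ
    have h := sd.apply_S' F ξ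
    rw [hξ, Sym.apply_lin] at h
    linear_combination -h
  have hR0 : sd.R F = fun _ => 0 := ((sd.continuous_R hF).ae_eq_iff_eq volume continuous_const).1 hR
  ext ξ
  rw [sd.apply_S' F ξ, hR0, Sym.apply_lin]
  ring

/-- **The spanning hypothesis for the coordinate `k`.** [folklore] -/
theorem lin_equiv_S : Sym.lin (stdOrthonormalBasis ℝ V k) ≈ sd.S :=
  (sd.lin_equiv_S').trans (sd.S_equiv_S').symm

end SpanData

/-- **The spanning hypothesis of the globalised data.** [folklore] -/
theorem spanHyp (sds : ∀ k, g.SpanData k) : g.d.SpanHyp fun k => (sds k).L :=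
  ⟨fun k => (sds k).isCoef_cert, fun k => (sds k).lin_equiv_S⟩

end GData

end Literature.Analysis.Hypoelliptic
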